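import Summits.CriticalPhenomena.PercolationContinuityZ3.Theorems.PercNearOneGluingNoHeavyLowerTailKnQuestion8CoefficientwiseCoreClassKernelMixLongThreadsBase
import Summits.CriticalPhenomena.PercolationContinuityZ3.Theorems.PercNearOneGluingNoHeavyLowerTailKnQuestion8CoefficientwiseCoreClassKernelMixShortThreadSplit
import HarnessLib

/-!
# ★ COROLLARY C: CONJECTURE IET on every bundle with at most three threads of length ≥ 3 (all monotone real levels, every up-closed event)

Support file (`--supports stmt-CriticalPhenomena-4575`, closed), prover `prim-cplus-coupling` (gen 70).  No definitions, no notations, no named facts,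
no sorries; standard axioms.  Memo `prim-cplus-coupling/A5-COUPLING-gen70.md` §8.

THEOREM `Coefficientwise.iet_bundle_threeLongThreads_fin` (finset-indexed threads) and `Coefficientwise.iet_bundle_threeLongThreads` (threads `0 … r−1`):
on an explicit bundle Θ(ℓ₁, …, ℓ_r) with hubs `u, b`, `r ≥ 2`, in which AT MOST THREE threads have length ≥ 3, the IET functional
`Σ_{𝒱, b∈X∖Y} h(X)k(X) + Σ_{𝒱, b∈Y∖X} (hᵃX − hᵇY)(kᵃX − kᵇY)` is nonnegative for EVERY up-closed event `𝒱` and ALL monotone levels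
`0 ≤ hᵃ, hᵇ ≤ h`, `0 ≤ kᵃ, kᵇ ≤ k` — CONJECTURE IET (the lane's Kozma–Nitzan-type kernel inequality) on Θ(2^a, 1^c, ℓ, ℓ′, ℓ″) for all a, c, ℓ, ℓ′, ℓ″:
Θ(2,3,3,3), Θ(2,2,3,3,3), Θ(1,2,4,4,5), …  It combines three earlier theorems of the lane: THEOREM A (`iet_split_shortThread`, gen 53: a thread of
length 2 is removed by an exact identity — two instances on the remaining bundle with levels shifted by the middle vertex + one instance with the thread
replaced by a `u–b` edge), THEOREM IET(3) (`iet_bundle_threeThreads`, gen 59: all three-thread bundles) and THEOREM IET(chorded) (`iet_bundle_withUnitThread`,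
gen 67: every bundle with a unit thread).  PROOF: strong induction on the number of edges (as in `iet_bundle_twoLongThreads`, gen 53, which stopped at two
long threads because the chorded base was then available only for three threads); bases `iet_base_twoThreads` (cycle), `iet_fin_withUnitThread`,
`iet_fin_threeThreads`.  First bundle outside the corollary: Θ(3,3,3,3).
[cite: KozmaNitzan2024, Questions 8–9 (§5.5 p. 36) (context); Harris 1960]
-/

namespace Summit.CriticalPhenomena.PercolationContinuityZ3.Theorems

open Finset Literature.Probability.Percolation

namespace Coefficientwise

variable {ι V : Type*}

open Classical in
/-- **THEOREM (IET, at most three long threads; finset-indexed form).**  Explicit bundle with thread index set `T`, `|T| ≥ 2`, at most three threads of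
length ≥ 3 (`hlong`): the IET sum is nonnegative for every up-closed event and all monotone real levels (module docstring).
[cite: KozmaNitzan2024, Questions 8–9 (§5.5 p. 36) (context); Harris 1960] -/
theorem iet_bundle_threeLongThreads_fin : ∀ (n : ℕ) (ends : ι → Sym2 V) (T : Finset ℕ) (L : ℕ → ℕ) (_hL : ∀ t ∈ T, 1 ≤ L t)
    (w : ℕ → ℕ → V) (e : ℕ → ℕ → ι) (u b : V)
    (_hw0 : ∀ t ∈ T, w t 0 = u) (_hwL : ∀ t ∈ T, w t (L t) = b)
    (_harc : ∀ t ∈ T, ∀ j, 1 ≤ j → j ≤ L t → ends (e t j) = s(w t (j - 1), w t j))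
    (_hwinj : ∀ t ∈ T, ∀ i j, i ≤ L t → j ≤ L t → w t i = w t j → i = j)
    (_hcross : ∀ t ∈ T, ∀ t' ∈ T, t ≠ t' → ∀ i j, i ≤ L t → j ≤ L t' → w t i = w t' j → (i = 0 ∧ j = 0) ∨ (i = L t ∧ j = L t'))
    (A : ℕ → Finset ι) (_hA : ∀ t ∈ T, ∀ i, i ∈ A t ↔ ∃ j, 1 ≤ j ∧ j ≤ L t ∧ e t j = i)
    (_hAdisj : ∀ t ∈ T, ∀ t' ∈ T, t ≠ t' → Disjoint (A t) (A t'))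
    (E : Finset ι) (_hEA : ∀ i, i ∈ E ↔ ∃ t ∈ T, i ∈ A t) (_hn : E.card = n)
    (_hT2 : 2 ≤ T.card) (_hlong : ∀ P : Finset ℕ, P ⊆ T → (∀ t ∈ P, 3 ≤ L t) → P.card ≤ 3)
    (𝒱 : Finset ι → Prop) (_hV : ∀ ⦃s t : Finset ι⦄, s ⊆ t → 𝒱 s → 𝒱 t)
    (h k ha hb ka kb : Set V → ℝ) (_mh : Monotone h) (_mk : Monotone k)
    (_mha : Monotone ha) (_mhb : Monotone hb) (_mka : Monotone ka) (_mkb : Monotone kb)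
    (_ha0 : ∀ S, 0 ≤ ha S) (_hah : ∀ S, ha S ≤ h S) (_hb0 : ∀ S, 0 ≤ hb S) (_hbh : ∀ S, hb S ≤ h S)
    (_ka0 : ∀ S, 0 ≤ ka S) (_kak : ∀ S, ka S ≤ k S) (_kb0 : ∀ S, 0 ≤ kb S) (_kbk : ∀ S, kb S ≤ k S),
    0 ≤ (∑ ω ∈ E.powerset, if 𝒱 ω ∧ b ∈ openCluster (ends '' (↑ω : Set ι)) u ∧ b ∉ openCluster (ends '' (↑(E \ ω) : Set ι)) u then
        h (openCluster (ends '' (↑ω : Set ι)) u) * k (openCluster (ends '' (↑ω : Set ι)) u) else 0)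
      + ∑ ω ∈ E.powerset, if 𝒱 ω ∧ b ∈ openCluster (ends '' (↑(E \ ω) : Set ι)) u ∧ b ∉ openCluster (ends '' (↑ω : Set ι)) u then
        (ha (openCluster (ends '' (↑ω : Set ι)) u) - hb (openCluster (ends '' (↑(E \ ω) : Set ι)) u)) *
          (ka (openCluster (ends '' (↑ω : Set ι)) u) - kb (openCluster (ends '' (↑(E \ ω) : Set ι)) u)) else 0 := by
  intro n
  induction n using Nat.strong_induction_on with
  | _ n IH =>
  intro ends T L hL w e u b hw0 hwL harc hwinj hcross A hA hAdisj E hEA hn hT2 hlong 𝒱 hV h k ha hb ka kb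
    mh mk mha mhb mka mkb ha0 hah hb0 hbh ka0 kak kb0 kbk
  -- common facts
  obtain ⟨p, hp⟩ : T.Nonempty := Finset.card_pos.mp (by omega)
  have hub : u ≠ b := by
    intro hub
    have := hwinj p hp 0 (L p) (Nat.zero_le _) (le_refl _) ((hw0 p hp).trans (hub.trans (hwL p hp).symm))
    have := hL p hp; omega
  have hAE : ∀ t ∈ T, A t ⊆ E := fun t ht i hi => (hEA i).mpr ⟨t, ht, hi⟩
  have hmono_ins : ∀ (x : V) (φ : Set V → ℝ), Monotone φ → Monotone (fun S : Set V => φ (insert x S)) :=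
    fun x φ hφ S S' hSS' => hφ (Set.insert_subset_insert hSS')
  -- restriction of the data to T.erase t₀ (edge set E \ A t₀)
  have hEA_erase : ∀ t₀ ∈ T, ∀ i, i ∈ E \ A t₀ ↔ ∃ t ∈ T.erase t₀, i ∈ A t := by
    intro t₀ ht₀ i
    rw [Finset.mem_sdiff, hEA i]
    constructor
    · rintro ⟨⟨t, ht, hi⟩, hn⟩
      refine ⟨t, Finset.mem_erase.mpr ⟨?_, ht⟩, hi⟩
      rintro rfl; exact hn hi
    · rintro ⟨t, ht, hi⟩
      rw [Finset.mem_erase] at ht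
      exact ⟨⟨t, ht.2, hi⟩, fun hi' => Finset.disjoint_left.mp (hAdisj t ht.2 t₀ ht₀ ht.1) hi hi'⟩
  have hcard_erase : ∀ t₀ ∈ T, (E \ A t₀).card = n - (A t₀).card := by
    intro t₀ ht₀
    rw [Finset.card_sdiff_of_subset (hAE t₀ ht₀), hn]
  -- a unit thread carries the pair s(u, b)
  have unit_edge : ∀ t ∈ T, L t = 1 → ends (e t 1) = s(u, b) ∧ (∀ i, i ∈ A t ↔ i = e t 1) := by
    intro t ht hL1
    refine ⟨?_, ?_⟩
    · have := harc t ht 1 (le_refl _) (by rw [hL1])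
      rw [hw0 t ht] at this
      rw [← hL1, hwL t ht] at this
      rw [hL1] at this; exact this
    · intro i
      rw [hA t ht i]
      constructor
      · rintro ⟨j, hj1, hjL, rfl⟩
        rw [hL1] at hjL
        have : j = 1 := by omega
        rw [this]
      · rintro rfl; exact ⟨1, le_refl _, by rw [hL1], rfl⟩
  -- ###### two threads: a cycle
  by_cases hc2 : T.card = 2
  · obtain ⟨p₁, q₁, hpq, hTpq⟩ := Finset.card_eq_two.mp hc2
    have hp₁ : p₁ ∈ T := by rw [hTpq]; exact Finset.mem_insert_self _ _
    have hq₁ : q₁ ∈ T := by rw [hTpq]; exact Finset.mem_insert_of_mem (Finset.mem_singleton_self _)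
    exact iet_base_twoThreads ends T L hL w e u b hw0 hwL harc hwinj hcross A hA hAdisj E hEA p₁ q₁ hp₁ hq₁ hpq
      (fun t ht => by rw [hTpq, Finset.mem_insert, Finset.mem_singleton] at ht; exact ht)
      𝒱 hV h k ha hb ka kb mh mk mha mhb mka mkb ha0 hah hb0 hbh ka0 kak kb0 kbk
  have hT3 : 3 ≤ T.card := by omega
  by_cases h2 : ∃ t₀ ∈ T, L t₀ = 2
  · -- ###### a thread of length 2: THEOREM A (iet_split_shortThread, gen 53) + three induction hypotheses
    obtain ⟨t₀, ht₀, hL2⟩ := h2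
    set f : ι := e t₀ 1 with hfdef
    set g : ι := e t₀ 2 with hgdef
    set x : V := w t₀ 1 with hxdef
    set E' : Finset ι := E \ A t₀ with hE'
    have hf : ends f = s(u, x) := by
      have := harc t₀ ht₀ 1 (le_refl _) (by rw [hL2]; omega)
      rw [hw0 t₀ ht₀] at this; exact this
    have hg : ends g = s(x, b) := by
      have := harc t₀ ht₀ 2 (by omega) (by rw [hL2])
      rw [← hL2, hwL t₀ ht₀] at this
      rw [hL2] at this; exact this
    have hxu : x ≠ u := by
      intro hxu'
      have := hwinj t₀ ht₀ 1 0 (by rw [hL2]; omega) (Nat.zero_le _) (hxu'.trans (hw0 t₀ ht₀).symm); omega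
    have hxb : x ≠ b := by
      intro hxb'
      have := hwinj t₀ ht₀ 1 (L t₀) (by rw [hL2]; omega) (le_refl _) (hxb'.trans (hwL t₀ ht₀).symm); omega
    have hfg : f ≠ g := by
      intro hfg'
      have := arc_edge_inj ends (L t₀) (w t₀) (e t₀) (harc t₀ ht₀) (hwinj t₀ ht₀) 1 2 (le_refl _) (by rw [hL2]; omega) (by omega)
        (by rw [hL2]) hfg'
      omega
    have hAt₀ : ∀ i, i ∈ A t₀ ↔ i = f ∨ i = g := by
      intro i
      rw [hA t₀ ht₀ i]
      constructor
      · rintro ⟨j, hj1, hjL, rfl⟩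
        rw [hL2] at hjL
        rcases Nat.lt_or_ge j 2 with hj | hj
        · left; have : j = 1 := by omega
          rw [this]
        · right; have : j = 2 := by omega
          rw [this]
      · rintro (rfl | rfl)
        · exact ⟨1, le_refl _, by rw [hL2]; omega, rfl⟩
        · exact ⟨2, by omega, by rw [hL2], rfl⟩
    have hfE' : f ∉ E' := fun h' => (Finset.mem_sdiff.mp h').2 ((hAt₀ f).mpr (Or.inl rfl))
    have hgE' : g ∉ E' := fun h' => (Finset.mem_sdiff.mp h').2 ((hAt₀ g).mpr (Or.inr rfl))
    have hE : E = insert f (insert g E') := by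
      ext i
      rw [Finset.mem_insert, Finset.mem_insert, hE', Finset.mem_sdiff, hAt₀]
      constructor
      · intro hi
        by_cases h1 : i = f
        · exact Or.inl h1
        · by_cases h2' : i = g
          · exact Or.inr (Or.inl h2')
          · exact Or.inr (Or.inr ⟨hi, fun h' => h'.elim h1 h2'⟩)
      · rintro (rfl | rfl | ⟨hi, _⟩)
        · exact hAE t₀ ht₀ ((hAt₀ f).mpr (Or.inl rfl))
        · exact hAE t₀ ht₀ ((hAt₀ g).mpr (Or.inr rfl))
        · exact hi
    have hxE' : ∀ i ∈ E', x ∉ ends i := by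
      intro i hi hxi
      obtain ⟨t, ht, hit⟩ := (hEA_erase t₀ ht₀ i).mp hi
      rw [Finset.mem_erase] at ht
      obtain ⟨j, hj1, hjL, rfl⟩ := (hA t ht.2 _).mp hit
      rw [harc t ht.2 j hj1 hjL, Sym2.mem_iff] at hxi
      rcases hxi with hx' | hx'
      · rcases hcross t₀ ht₀ t ht.2 (Ne.symm ht.1) 1 (j - 1) (by rw [hL2]; omega) (by omega) hx' with ⟨h0, _⟩ | ⟨h0, _⟩
        · omega
        · rw [hL2] at h0; omega
      · rcases hcross t₀ ht₀ t ht.2 (Ne.symm ht.1) 1 j (by rw [hL2]; omega) hjL hx' with ⟨h0, _⟩ | ⟨h0, _⟩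
        · omega
        · rw [hL2] at h0; omega
    -- the modified data: thread t₀ replaced by the single edge f with ends′ f = s(u, b)
    set ends' : ι → Sym2 V := Function.update ends f s(u, b) with hends'def
    have hends' : ∀ i ∈ E', ends' i = ends i := by
      intro i hi
      have : i ≠ f := fun h' => hfE' (h' ▸ hi)
      simp only [hends'def, Function.update_of_ne this]
    have hf' : ends' f = s(u, b) := by simp only [hends'def, Function.update_self]
    rw [hE, iet_split_shortThread ends ends' E' f g u b x hfg hfE' hgE' hf hg hxu hxb hub hxE' hends' hf' 𝒱 h k ha hb ka kb]
    have hcardE' : E'.card = n - 2 := by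
      rw [hE', hcard_erase t₀ ht₀]
      congr 1
      rw [Finset.card_eq_two]
      exact ⟨f, g, hfg, by ext i; rw [hAt₀, Finset.mem_insert, Finset.mem_singleton]⟩
    have hnge2 : 2 ≤ n := by
      rw [← hn, hE, Finset.card_insert_of_notMem (by rw [Finset.mem_insert]; rintro (h' | h'); exact hfg h'; exact hfE' h'),
        Finset.card_insert_of_notMem hgE']
      omega
    have hn2 : n - 2 < n := by omega
    have hT' : ∀ t ∈ T.erase t₀, t ∈ T := fun t ht => (Finset.mem_erase.mp ht).2
    have hT2' : 2 ≤ (T.erase t₀).card := by rw [Finset.card_erase_of_mem ht₀]; omega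
    have hlong' : ∀ P : Finset ℕ, P ⊆ T.erase t₀ → (∀ t ∈ P, 3 ≤ L t) → P.card ≤ 3 :=
      fun P hP hP3 => hlong P (hP.trans (Finset.erase_subset _ _)) hP3
    have hlongU : ∀ P : Finset ℕ, P ⊆ T → (∀ t ∈ P, 3 ≤ Function.update L t₀ 1 t) → P.card ≤ 3 := by
      intro P hP hP3
      refine hlong P hP (fun t ht => ?_)
      have h3 := hP3 t ht
      by_cases htt : t = t₀
      · subst htt; rw [Function.update_self] at h3; omega
      · rw [Function.update_of_ne htt] at h3; exact h3
    refine add_nonneg (add_nonneg ?_ ?_) ?_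
    · -- slice f red, g blue: the bundle without t₀, all levels shifted by x
      exact IH (n - 2) hn2 ends (T.erase t₀) L (fun t ht => hL t (hT' t ht)) w e u b (fun t ht => hw0 t (hT' t ht))
        (fun t ht => hwL t (hT' t ht)) (fun t ht => harc t (hT' t ht)) (fun t ht => hwinj t (hT' t ht))
        (fun t ht t' ht' hne => hcross t (hT' t ht) t' (hT' t' ht') hne) A (fun t ht => hA t (hT' t ht))
        (fun t ht t' ht' hne => hAdisj t (hT' t ht) t' (hT' t' ht') hne) E' (hEA_erase t₀ ht₀) hcardE'
        hT2' hlong'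
        (fun η => 𝒱 (insert f η)) (fun s t hst hs => hV (Finset.insert_subset_insert f hst) hs)
        (fun S => h (insert x S)) (fun S => k (insert x S)) (fun S => ha (insert x S)) (fun S => hb (insert x S))
        (fun S => ka (insert x S)) (fun S => kb (insert x S))
        (hmono_ins x h mh) (hmono_ins x k mk) (hmono_ins x ha mha) (hmono_ins x hb mhb) (hmono_ins x ka mka) (hmono_ins x kb mkb)
        (fun S => ha0 _) (fun S => hah _) (fun S => hb0 _) (fun S => hbh _) (fun S => ka0 _) (fun S => kak _) (fun S => kb0 _) (fun S => kbk _)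
    · -- slice g red, f blue: h, k, hᵇ, kᵇ shifted by x
      exact IH (n - 2) hn2 ends (T.erase t₀) L (fun t ht => hL t (hT' t ht)) w e u b (fun t ht => hw0 t (hT' t ht))
        (fun t ht => hwL t (hT' t ht)) (fun t ht => harc t (hT' t ht)) (fun t ht => hwinj t (hT' t ht))
        (fun t ht t' ht' hne => hcross t (hT' t ht) t' (hT' t' ht') hne) A (fun t ht => hA t (hT' t ht))
        (fun t ht t' ht' hne => hAdisj t (hT' t ht) t' (hT' t' ht') hne) E' (hEA_erase t₀ ht₀) hcardE'
        hT2' hlong'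
        (fun η => 𝒱 (insert g η)) (fun s t hst hs => hV (Finset.insert_subset_insert g hst) hs)
        (fun S => h (insert x S)) (fun S => k (insert x S)) ha (fun S => hb (insert x S)) ka (fun S => kb (insert x S))
        (hmono_ins x h mh) (hmono_ins x k mk) mha (hmono_ins x hb mhb) mka (hmono_ins x kb mkb)
        ha0 (fun S => (hah S).trans (mh (Set.subset_insert x S))) (fun S => hb0 _) (fun S => hbh _)
        ka0 (fun S => (kak S).trans (mk (Set.subset_insert x S))) (fun S => kb0 _) (fun S => kbk _)
    · -- boundary slices: the bundle with t₀ replaced by the edge f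
      have hcard1 : (insert f E').card = n - 1 := by
        rw [Finset.card_insert_of_notMem hfE', hcardE']; omega
      obtain ⟨hL', hw0', hwL', harc', hwinj', hcross', hA', hAdisj', hEA'⟩ :=
        bundleData_unitReplace ends T L hL w e u b hw0 hwL harc hwinj hcross A hA hAdisj E hEA t₀ ht₀
      exact IH (n - 1) (by omega) ends' T (Function.update L t₀ 1) hL' (Function.update w t₀ (fun j => if j = 0 then u else b)) e u b
        hw0' hwL' harc' hwinj' hcross' (Function.update A t₀ {f}) hA' hAdisj' (insert f E') hEA' hcard1 hT2 hlongU
        (fun ω => 𝒱 (if f ∈ ω then insert g ω else ω)) (upClosed_insert_if 𝒱 hV f g)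
        (fun S => h (insert x S)) (fun S => k (insert x S)) ha (fun S => hb (insert x S)) ka (fun S => kb (insert x S))
        (hmono_ins x h mh) (hmono_ins x k mk) mha (hmono_ins x hb mhb) mka (hmono_ins x kb mkb)
        ha0 (fun S => (hah S).trans (mh (Set.subset_insert x S))) (fun S => hb0 _) (fun S => hbh _)
        ka0 (fun S => (kak S).trans (mk (Set.subset_insert x S))) (fun S => kb0 _) (fun S => kbk _)
  -- ###### no thread of length 2: a unit thread, or exactly three (long) threads
  by_cases h1 : ∃ t₀ ∈ T, L t₀ = 1
  · obtain ⟨t₀, ht₀, hL1⟩ := h1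
    exact iet_fin_withUnitThread ends T L hL w e u b hw0 hwL harc hwinj hcross A hA hAdisj E hEA t₀ ht₀ hL1
      𝒱 hV h k ha hb ka kb mh mk mha mhb mka mkb ha0 hah hb0 hbh ka0 kak kb0 kbk
  · have hall : ∀ t ∈ T, 3 ≤ L t := by
      intro t ht
      have h1' := hL t ht
      by_contra hlt
      rcases Nat.lt_or_ge (L t) 2 with hl | hl
      · exact h1 ⟨t, ht, by omega⟩
      · exact h2 ⟨t, ht, by omega⟩
    have hc3 : T.card = 3 := le_antisymm (hlong T (Finset.Subset.refl _) hall) hT3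
    exact iet_fin_threeThreads ends T L hL w e u b hw0 hwL harc hwinj hcross A hA hAdisj E hEA hc3
      𝒱 hV h k ha hb ka kb mh mk mha mhb mka mkb ha0 hah hb0 hbh ka0 kak kb0 kbk

open Classical in
/-- **★ COROLLARY C (CONJECTURE IET on every bundle with at most three threads of length ≥ 3).**  Explicit bundle with threads `0, …, r−1`, `r ≥ 2`
(hypotheses as in `iet_boundary_bundle`), such that at most three threads have length `≥ 3` (`hlong`): for EVERY up-closed event `𝒱` and all
monotone real levels `0 ≤ hᵃ, hᵇ ≤ h`, `0 ≤ kᵃ, kᵇ ≤ k`,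
`0 ≤ Σ_{ω ⊆ E : 𝒱 ω, b ∈ X∖Y} h(X)k(X) + Σ_{ω ⊆ E : 𝒱 ω, b ∈ Y∖X} (hᵃX − hᵇY)(kᵃX − kᵇY)`, `X = C_u(ω)`, `Y = C_u(E∖ω)`.
Covers Θ(2,3,3,3), Θ(2,2,4,4,5), Θ(1,2,ℓ,ℓ′,ℓ″), … ; first case outside: Θ(3,3,3,3).
[cite: KozmaNitzan2024, Questions 8–9 (§5.5 p. 36) (context); Harris 1960] -/
theorem iet_bundle_threeLongThreads (ends : ι → Sym2 V) (r : ℕ) (L : ℕ → ℕ) (hL : ∀ t, t < r → 1 ≤ L t)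
    (w : ℕ → ℕ → V) (e : ℕ → ℕ → ι) (u b : V)
    (hw0 : ∀ t, t < r → w t 0 = u) (hwL : ∀ t, t < r → w t (L t) = b)
    (harc : ∀ t, t < r → ∀ j, 1 ≤ j → j ≤ L t → ends (e t j) = s(w t (j - 1), w t j))
    (hwinj : ∀ t, t < r → ∀ i j, i ≤ L t → j ≤ L t → w t i = w t j → i = j)
    (hcross : ∀ t t', t < r → t' < r → t ≠ t' → ∀ i j, i ≤ L t → j ≤ L t' → w t i = w t' j → (i = 0 ∧ j = 0) ∨ (i = L t ∧ j = L t'))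
    (A : ℕ → Finset ι) (hA : ∀ t, t < r → ∀ i, i ∈ A t ↔ ∃ j, 1 ≤ j ∧ j ≤ L t ∧ e t j = i)
    (hAdisj : ∀ t t', t < r → t' < r → t ≠ t' → Disjoint (A t) (A t'))
    (E : Finset ι) (hEA : ∀ i, i ∈ E ↔ ∃ t, t < r ∧ i ∈ A t)
    (hr : 2 ≤ r) (hlong : ∀ P : Finset ℕ, (∀ t ∈ P, t < r ∧ 3 ≤ L t) → P.card ≤ 3)
    (𝒱 : Finset ι → Prop) (hV : ∀ ⦃s t : Finset ι⦄, s ⊆ t → 𝒱 s → 𝒱 t)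
    (h k ha hb ka kb : Set V → ℝ) (mh : Monotone h) (mk : Monotone k)
    (mha : Monotone ha) (mhb : Monotone hb) (mka : Monotone ka) (mkb : Monotone kb)
    (ha0 : ∀ S, 0 ≤ ha S) (hah : ∀ S, ha S ≤ h S) (hb0 : ∀ S, 0 ≤ hb S) (hbh : ∀ S, hb S ≤ h S)
    (ka0 : ∀ S, 0 ≤ ka S) (kak : ∀ S, ka S ≤ k S) (kb0 : ∀ S, 0 ≤ kb S) (kbk : ∀ S, kb S ≤ k S) :
    0 ≤ (∑ ω ∈ E.powerset, if 𝒱 ω ∧ b ∈ openCluster (ends '' (↑ω : Set ι)) u ∧ b ∉ openCluster (ends '' (↑(E \ ω) : Set ι)) u then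
        h (openCluster (ends '' (↑ω : Set ι)) u) * k (openCluster (ends '' (↑ω : Set ι)) u) else 0)
      + ∑ ω ∈ E.powerset, if 𝒱 ω ∧ b ∈ openCluster (ends '' (↑(E \ ω) : Set ι)) u ∧ b ∉ openCluster (ends '' (↑ω : Set ι)) u then
        (ha (openCluster (ends '' (↑ω : Set ι)) u) - hb (openCluster (ends '' (↑(E \ ω) : Set ι)) u)) *
          (ka (openCluster (ends '' (↑ω : Set ι)) u) - kb (openCluster (ends '' (↑(E \ ω) : Set ι)) u)) else 0 := by
  have mem : ∀ t, t ∈ Finset.range r ↔ t < r := fun t => Finset.mem_range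
  exact iet_bundle_threeLongThreads_fin E.card ends (Finset.range r) L (fun t ht => hL t ((mem t).mp ht)) w e u b
    (fun t ht => hw0 t ((mem t).mp ht)) (fun t ht => hwL t ((mem t).mp ht)) (fun t ht => harc t ((mem t).mp ht))
    (fun t ht => hwinj t ((mem t).mp ht)) (fun t ht t' ht' hne => hcross t t' ((mem t).mp ht) ((mem t').mp ht') hne)
    A (fun t ht => hA t ((mem t).mp ht)) (fun t ht t' ht' hne => hAdisj t t' ((mem t).mp ht) ((mem t').mp ht') hne)
    E (fun i => by rw [hEA i]; exact ⟨fun ⟨t, ht, hi⟩ => ⟨t, (mem t).mpr ht, hi⟩, fun ⟨t, ht, hi⟩ => ⟨t, (mem t).mp ht, hi⟩⟩) rfl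
    (by rw [Finset.card_range]; exact hr) (fun P hP hP3 => hlong P (fun t ht => ⟨(mem t).mp (hP ht), hP3 t ht⟩))
    𝒱 hV h k ha hb ka kb mh mk mha mhb mka mkb ha0 hah hb0 hbh ka0 kak kb0 kbk

end Coefficientwise

end Summit.CriticalPhenomena.PercolationContinuityZ3.Theorems
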